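import Mathlib
import Literature.Analysis.FluidPDE.KNSSTypeIRateMildProofs
import Literature.Analysis.FluidPDE.ClassicalBoundedUniformDerivativeBounds
import Summits.NavierStokesRegularity.OSWSelfSimilar.TypeIIInnerLimitExtraction
import HarnessLib
/-!
# The N-a zoom of a blow-up solution is Oseen-mild: (I-2) from the standing hypotheses (zone Z1 TEMPLATE §T1.4-I, kernel)

HONEST FRAMING (cell ns-blowup GROUP B «PROFILE SEARCH», zone Z1; D-0035/D-0074): part XX of the Z1 dictionary. Part XIX
(`TypeIIInnerLimitExtraction`) produced the inner object from zoom fields `w⁽ᵏ⁾` that are CLASSICAL and OSEEN-MILD on their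
windows — the last INPUT listed in §T1.27 (K37). This file discharges it from the pre-limit solution: for a classical
solution `u` of Navier–Stokes (`ν = 1`, unforced) on `[0, T⋆) × ℝ³`, bounded and of bounded energy on every closed sub-slab
(K8's standing hypotheses: classical + Leray–Hopf + bounded on sub-slabs), the zoom
`w⁽ᵏ⁾(s, y) = λₖ u(tₖ + λₖ² s, xₖ + λₖ y)` (`λₖ • stPull λₖ² λₖ tₖ xₖ u`) is classical on `(A_k, B_k) = (−tₖ/λₖ², (T⋆−tₖ)/λₖ²)`
(`IsClassicalNSSolutionOn.nsRescale_translate_zero`) and satisfies the Oseen integral equation between all its times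
(restarted Oseen identity of the bounded finite-energy classical solution,
`IsClassicalNSSolutionOn.eq_heatExtension_sub_oseenDuhamel_of_bounded`, transported by the parabolic covariance
`oseen_smul_stPull` — all tree theorems):

* `zoom_isClassical` / `zoom_oseenMild` — the two inputs of part XIX for the zoom of `u`;
* `innerLimit_exists_of_blowup_zoom` — **(I-2) FROM THE STANDING HYPOTHESES**: if moreover `λₖ → 0` with `tₖ ≥ t₁ > 0`
  (so `A_k → −∞`), `λₖ‖u(t, x)‖ ≤ 1` on `[0, tₖ]` (gauge N-a: `λₖ = 1/sup_{[0,tₖ]}‖u‖`, `tₖ` a running-max time) and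
  `λₖ‖u(tₖ, xₖ)‖ → 1` (near-maximal centres), a subsequence of the zoom converges slice-wise locally uniformly to a KNSS
  blow-up limit — the TEMPLATE's inner object EXISTS, with its convergence, by decl;
* `exists_zoom_data_of_unbounded` — such `tₖ, xₖ, λₖ` EXIST as soon as `u` is unbounded on `[0, T⋆) × ℝ³` (near-maxima
  of the running supremum), and `innerLimit_exists_of_unbounded` — **(I-2) from the standing hypotheses + unboundedness
  alone**.

**Nothing here asserts that `u` blows up (is unbounded).** «violates: n/a — dictionary»; bears_on
LADDER-NS N5/Z1 → N1 linear core / N0⁻ ((I-2)). Author: ns-blowup-profile-eng-1 g7, 2026-08-27.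
-/

open Real Filter Topology Set MeasureTheory Function
open scoped ENNReal
open Literature.Analysis.FluidPDE

namespace Summit.NavierStokesRegularity.OSWSelfSimilar
namespace TypeIIModulationDictionary

section ZoomOseen

variable {T : ℝ} {u : ℝ → EuclideanSpace ℝ (Fin 3) → EuclideanSpace ℝ (Fin 3)}
  {p : ℝ → EuclideanSpace ℝ (Fin 3) → ℝ}

/-- **The zoom of a classical solution is classical on the zoomed window**: for `u` classical (`ν = 1`, unforced) on
`[0, T⋆) × ℝ³`, `0 < λ`, `t₀ ∈ ℝ`, the field `λ • stPull λ² λ t₀ x₀ u` (i.e. `(s, y) ↦ λ u(t₀ + λ²s, x₀ + λy)`) is classical on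
the open window `(−t₀/λ², (T⋆ − t₀)/λ²)` (`IsClassicalNSSolutionOn.nsRescale_translate_zero`, restricted).
[new here — dictionary] -/
theorem zoom_isClassical (hu : IsClassicalNSSolutionOn (Ico 0 T) 1 0 u p) {lam : ℝ} (hlam : 0 < lam)
    (t₀ : ℝ) (x₀ : EuclideanSpace ℝ (Fin 3)) :
    IsClassicalNSSolutionOn (Ioo (-t₀ / lam ^ 2) ((T - t₀) / lam ^ 2)) 1 0
      (lam • stPull (lam ^ 2) lam t₀ x₀ u) (lam ^ 2 • stPull (lam ^ 2) lam t₀ x₀ p) := by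
  have h := hu.nsRescale_translate_zero hlam t₀ x₀
  have hl2 : 0 < lam ^ 2 := by positivity
  refine h.mono (fun r hr => ?_) (uniqueDiffOn_Ioo _ _)
  simp only [mem_preimage, mem_Ico]
  constructor
  · have := hr.1; rw [div_lt_iff₀ hl2] at this; linarith
  · have := hr.2; rw [lt_div_iff₀ hl2] at this; linarith

/-- **The zoom of a bounded finite-energy classical solution is Oseen-mild on its window.** If `u` is classical
(`ν = 1`, unforced) on `[0, T⋆)`, bounded and of bounded energy on every `[0, S]`, `S < T⋆`, then for `0 < λ` and
`−t₀/λ² < σ < τ < (T⋆ − t₀)/λ²` the zoom `w = λ • stPull λ² λ t₀ x₀ u` satisfies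
`w(τ) = e^{(τ−σ)Δ}w(σ) − B¹_σ(w, w)(τ)` pointwise: the restarted Oseen identity of `u` between `t₀ + λ²σ ≥ 0` and
`t₀ + λ²τ < T⋆` (`IsClassicalNSSolutionOn.eq_heatExtension_sub_oseenDuhamel_of_bounded`) transported by the parabolic
covariance `oseen_smul_stPull`. [new here — dictionary] -/
theorem zoom_oseenMild (hu : IsClassicalNSSolutionOn (Ico 0 T) 1 0 u p)
    (hE : ∀ S < T, ∃ C : ℝ≥0∞, C < ⊤ ∧ ∀ t ∈ Icc 0 S, ∫⁻ x, ‖u t x‖ₑ ^ 2 ≤ C)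
    (hbdd : ∀ S < T, ∃ N : ℝ, 0 < N ∧ ∀ t ∈ Icc 0 S, ∀ x, ‖u t x‖ ≤ N)
    {lam : ℝ} (hlam : 0 < lam) (t₀ : ℝ) (x₀ : EuclideanSpace ℝ (Fin 3)) {σ τ : ℝ}
    (hσ : -t₀ / lam ^ 2 < σ) (hστ : σ < τ) (hτ : τ < (T - t₀) / lam ^ 2) (y : EuclideanSpace ℝ (Fin 3)) :
    (lam • stPull (lam ^ 2) lam t₀ x₀ u) τ y =
      Literature.Analysis.UnboundedOperators.heatExtension ((lam • stPull (lam ^ 2) lam t₀ x₀ u) σ) (τ - σ) y -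
        oseenDuhamel 1 σ (lam • stPull (lam ^ 2) lam t₀ x₀ u) (lam • stPull (lam ^ 2) lam t₀ x₀ u) τ y := by
  have hl2 : 0 < lam ^ 2 := by positivity
  -- the physical times `s' = t₀ + λ²σ ≥ 0` and `t' = t₀ + λ²τ < T⋆`
  have hs' : 0 ≤ t₀ + lam ^ 2 * σ := by
    have := hσ; rw [div_lt_iff₀ hl2] at this; linarith
  have hst' : t₀ + lam ^ 2 * σ < t₀ + lam ^ 2 * τ := by nlinarith
  have ht' : t₀ + lam ^ 2 * τ < T := by
    have := hτ; rw [lt_div_iff₀ hl2] at this; linarith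
  -- the restarted Oseen identity of `u` on `[0, S]`, `S = t₀ + λ²τ`
  set S : ℝ := t₀ + lam ^ 2 * τ with hS
  have hS0 : 0 < S := lt_of_le_of_lt hs' hst'
  have huS : IsClassicalNSSolutionOn (Icc 0 S) 1 0 u p :=
    hu.mono (fun t ht => ⟨ht.1, ht.2.trans_lt ht'⟩) (uniqueDiffOn_Icc hS0)
  obtain ⟨C, hC, hEC⟩ := hE S ht'
  obtain ⟨N, hN, hbN⟩ := hbdd S ht'
  have hrep : ∀ X, u (t₀ + lam ^ 2 * τ) X =
      Literature.Analysis.UnboundedOperators.heatExtension (u (t₀ + lam ^ 2 * σ))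
        (t₀ + lam ^ 2 * τ - (t₀ + lam ^ 2 * σ)) X -
        oseenDuhamel 1 (t₀ + lam ^ 2 * σ) u u (t₀ + lam ^ 2 * τ) X := fun X =>
    huS.eq_heatExtension_sub_oseenDuhamel_of_bounded ⟨C, hC, hEC⟩ hN hbN hs' hst' le_rfl X
  exact oseen_smul_stPull hlam t₀ x₀ hστ hrep y

/-- **TEMPLATE (I-2) FROM THE STANDING HYPOTHESES: the inner object exists, with the convergence of the zoom.** Let `u`
be a classical solution (`ν = 1`, unforced) on `[0, T⋆) × ℝ³`, bounded and of bounded energy on every closed sub-slab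
(K8's class), and let `tₖ ∈ [t₁, T⋆)` (`t₁ > 0`), `xₖ ∈ ℝ³`, `λₖ > 0` with `λₖ → 0`, `λₖ‖u(t, x)‖ ≤ 1` for `t ∈ [0, tₖ]`
(the gauge N-a at running-max times: `λₖ = 1/sup_{[0,tₖ]}‖u‖`) and `λₖ‖u(tₖ, xₖ)‖ → 1` (near-maximal centres). Then a
subsequence of the zoom `w⁽ᵏ⁾ = λₖ • stPull λₖ² λₖ tₖ xₖ u` converges slice-wise locally uniformly at every `s < 0` to a KNSS
blow-up limit `W` (`IsKNSSBlowupLimit`). Every hypothesis of part XIX's `innerLimit_exists_of_zoom` is discharged here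
(`zoom_isClassical`, `zoom_oseenMild`). [new here — dictionary] -/
theorem innerLimit_exists_of_blowup_zoom (hu : IsClassicalNSSolutionOn (Ico 0 T) 1 0 u p)
    (hE : ∀ S < T, ∃ C : ℝ≥0∞, C < ⊤ ∧ ∀ t ∈ Icc 0 S, ∫⁻ x, ‖u t x‖ₑ ^ 2 ≤ C)
    (hbdd : ∀ S < T, ∃ N : ℝ, 0 < N ∧ ∀ t ∈ Icc 0 S, ∀ x, ‖u t x‖ ≤ N)
    {tn lamn : ℕ → ℝ} {xn : ℕ → EuclideanSpace ℝ (Fin 3)} {t₁ : ℝ} (ht₁ : 0 < t₁)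
    (htn : ∀ k, t₁ ≤ tn k ∧ tn k < T) (hlam : ∀ k, 0 < lamn k) (hlam0 : Tendsto lamn atTop (𝓝 0))
    (hgauge : ∀ k, ∀ t ∈ Icc 0 (tn k), ∀ x, lamn k * ‖u t x‖ ≤ 1)
    (hnear : Tendsto (fun k => lamn k * ‖u (tn k) (xn k)‖) atTop (𝓝 1)) :
    ∃ (φ : ℕ → ℕ) (W : ℝ → EuclideanSpace ℝ (Fin 3) → EuclideanSpace ℝ (Fin 3)), StrictMono φ ∧
      IsKNSSBlowupLimit W ∧
      ∀ s < 0, TendstoLocallyUniformly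
        (fun k => (lamn (φ k) • stPull (lamn (φ k) ^ 2) (lamn (φ k)) (tn (φ k)) (xn (φ k)) u) s) (W s) atTop := by
  -- the windows
  set A : ℕ → ℝ := fun k => -tn k / lamn k ^ 2 with hA
  set B : ℕ → ℝ := fun k => (T - tn k) / lamn k ^ 2 with hB
  have hBpos : ∀ k, 0 < B k := fun k => div_pos (sub_pos.2 (htn k).2) (pow_pos (hlam k) 2)
  -- `A k → −∞`: `A k ≤ −t₁ / λₖ²` and `λₖ² → 0⁺`
  have hAlim : Tendsto A atTop atBot := by
    have hl2 : Tendsto (fun k => lamn k ^ 2) atTop (𝓝[>] 0) := by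
      refine tendsto_nhdsWithin_iff.2 ⟨by simpa using hlam0.pow 2, Eventually.of_forall fun k => ?_⟩
      exact pow_pos (hlam k) 2
    have hinv : Tendsto (fun k => (lamn k ^ 2)⁻¹) atTop atTop := tendsto_inv_nhdsGT_zero.comp hl2
    have hmaj : Tendsto (fun k => -t₁ * (lamn k ^ 2)⁻¹) atTop atBot :=
      hinv.const_mul_atTop_of_neg (by linarith)
    refine tendsto_atBot_mono (fun k => ?_) hmaj
    have hl2k : 0 < lamn k ^ 2 := pow_pos (hlam k) 2
    rw [hA]
    show -tn k / lamn k ^ 2 ≤ -t₁ * (lamn k ^ 2)⁻¹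
    rw [div_eq_mul_inv]
    exact mul_le_mul_of_nonneg_right (by linarith [(htn k).1]) (inv_nonneg.2 hl2k.le)
  -- the inputs of part XIX
  refine innerLimit_exists_of_zoom (A := A) (B := B)
    (w := fun k => lamn k • stPull (lamn k ^ 2) (lamn k) (tn k) (xn k) u)
    (q := fun k => lamn k ^ 2 • stPull (lamn k ^ 2) (lamn k) (tn k) (xn k) p) hAlim hBpos
    (fun k => zoom_isClassical hu (hlam k) (tn k) (xn k))
    (fun k s t hs hst ht x => zoom_oseenMild hu hE hbdd (hlam k) (tn k) (xn k) hs hst ht x)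
    (fun k τ hτ x => ?_) ?_
  · -- the bound `‖w⁽ᵏ⁾‖ ≤ 1` on `(A k, 0]`: physical time `tₖ + λₖ²τ ∈ [0, tₖ]`
    have hl2k : 0 < lamn k ^ 2 := pow_pos (hlam k) 2
    have h1 : 0 ≤ tn k + lamn k ^ 2 * τ := by
      have := hτ.1; rw [hA] at this
      have : -tn k / lamn k ^ 2 < τ := this
      rw [div_lt_iff₀ hl2k] at this; linarith
    have h2 : tn k + lamn k ^ 2 * τ ≤ tn k := by nlinarith [hτ.2]
    have h := hgauge k (tn k + lamn k ^ 2 * τ) ⟨h1, h2⟩ (xn k + lamn k • x)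
    simpa [stPull_apply, norm_smul, abs_of_pos (hlam k)] using h
  · -- the vertex value `‖w⁽ᵏ⁾(0, 0)‖ = λₖ‖u(tₖ, xₖ)‖ → 1`
    refine hnear.congr fun k => ?_
    simp [stPull_apply, norm_smul, abs_of_pos (hlam k)]

/-- **The N-a zoom data exist as soon as the solution is unbounded** (KNSS 2009, proof of Prop. 6.1, p. 11: the choice of
`(x_k, t_k)` near the running maxima). If `u` is bounded on every `[0, S] × ℝ³`, `S < T⋆`, but unbounded on `[0, T⋆) × ℝ³`,
then there are `tₖ ∈ [T⋆/2, T⋆)`, `xₖ`, `λₖ > 0` with `λₖ → 0`, `λₖ‖u(t, x)‖ ≤ 1` on `[0, tₖ] × ℝ³` (`λₖ = 1/sup_{[0,tₖ]}‖u‖`)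
and `λₖ‖u(tₖ, xₖ)‖ → 1` — the hypotheses of `innerLimit_exists_of_blowup_zoom`. Construction: a point `(sₖ, ·)` with
`‖u‖ > (k+2)(N₁+1)` (`N₁` the bound on `[0, T⋆/2]`), then a near-maximum `(tₖ, xₖ)` of `‖u‖` over `[0, sₖ] × ℝ³` within the
factor `1 − 1/(k+2)`, and `λₖ = 1/sup_{[0,tₖ]}‖u‖`. [new here — dictionary] -/
theorem exists_zoom_data_of_unbounded (hT : 0 < T)
    (hbdd : ∀ S < T, ∃ N : ℝ, 0 < N ∧ ∀ t ∈ Icc 0 S, ∀ x, ‖u t x‖ ≤ N)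
    (hunb : ∀ N : ℝ, ∃ t ∈ Ico 0 T, ∃ x : EuclideanSpace ℝ (Fin 3), N < ‖u t x‖) :
    ∃ (tn lamn : ℕ → ℝ) (xn : ℕ → EuclideanSpace ℝ (Fin 3)),
      (∀ k, T / 2 ≤ tn k ∧ tn k < T) ∧ (∀ k, 0 < lamn k) ∧ Tendsto lamn atTop (𝓝 0) ∧
      (∀ k, ∀ t ∈ Icc 0 (tn k), ∀ x, lamn k * ‖u t x‖ ≤ 1) ∧
      Tendsto (fun k => lamn k * ‖u (tn k) (xn k)‖) atTop (𝓝 1) := by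
  obtain ⟨N₁, hN₁, hbN₁⟩ := hbdd (T / 2) (by linarith)
  -- the running supremum `Msup s = sup_{[0,s] × ℝ³} ‖u‖` for `s < T`
  set V : ℝ → Set ℝ := fun s => (fun q : ℝ × EuclideanSpace ℝ (Fin 3) => ‖u q.1 q.2‖) '' (Icc 0 s ×ˢ univ)
    with hV
  have hVne : ∀ s, 0 ≤ s → (V s).Nonempty := fun s hs =>
    ⟨_, ⟨(0, 0), ⟨⟨le_rfl, hs⟩, mem_univ _⟩, rfl⟩⟩
  have hVbdd : ∀ s < T, BddAbove (V s) := fun s hs => by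
    obtain ⟨N, -, hbN⟩ := hbdd s hs
    refine ⟨N, ?_⟩
    rintro r ⟨⟨t, x⟩, ⟨ht, -⟩, rfl⟩
    exact hbN t ht x
  have hle : ∀ s < T, ∀ t ∈ Icc 0 s, ∀ x, ‖u t x‖ ≤ sSup (V s) := fun s hs t ht x =>
    le_csSup (hVbdd s hs) ⟨(t, x), ⟨ht, mem_univ _⟩, rfl⟩
  -- step 1: points with large values, `‖u (s k) (y k)‖ > R k := (k+2)(N₁+1)`
  set R : ℕ → ℝ := fun k => ((k : ℝ) + 2) * (N₁ + 1) with hR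
  have hRpos : ∀ k, 0 < R k := fun k => by positivity
  have hbig : ∀ k : ℕ, ∃ s ∈ Ico 0 T, ∃ y : EuclideanSpace ℝ (Fin 3), R k < ‖u s y‖ := fun k => hunb (R k)
  choose s hs y hy using hbig
  -- step 2: a near-maximum of `‖u‖` over `[0, s k] × ℝ³`
  have hM : ∀ k, 0 < sSup (V (s k)) := fun k =>
    (hRpos k).trans (lt_of_lt_of_le (hy k) (hle (s k) (hs k).2 (s k) ⟨(hs k).1, le_rfl⟩ (y k)))
  have hnear : ∀ k : ℕ, ∃ t ∈ Icc 0 (s k), ∃ x : EuclideanSpace ℝ (Fin 3),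
      (1 - 1 / ((k : ℝ) + 2)) * sSup (V (s k)) < ‖u t x‖ := by
    intro k
    have hlt : (1 - 1 / ((k : ℝ) + 2)) * sSup (V (s k)) < sSup (V (s k)) := by
      have h2 : (0 : ℝ) < 1 / ((k : ℝ) + 2) := by positivity
      nlinarith [hM k]
    obtain ⟨r, ⟨⟨t, x⟩, ⟨ht, -⟩, rfl⟩, hr⟩ := exists_lt_of_lt_csSup (hVne (s k) (hs k).1) hlt
    exact ⟨t, ht, x, hr⟩
  choose tn htn xn hxn using hnear
  -- step 3: the scale `λ k = 1 / sup_{[0, t k]} ‖u‖`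
  have htT : ∀ k, tn k < T := fun k => (htn k).2.trans_lt (hs k).2
  have hM' : ∀ k, 0 < sSup (V (tn k)) := by
    intro k
    have h1 : 0 < (1 - 1 / ((k : ℝ) + 2)) * sSup (V (s k)) := by
      have : (1 : ℝ) / ((k : ℝ) + 2) < 1 := by
        rw [div_lt_one (by positivity)]; linarith
      exact mul_pos (by linarith) (hM k)
    exact h1.trans ((hxn k).trans_le (hle (tn k) (htT k) (tn k) ⟨(htn k).1, le_rfl⟩ (xn k)))
  set lamn : ℕ → ℝ := fun k => (sSup (V (tn k)))⁻¹ with hlamn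
  -- the value at the chosen point dominates `R k / 2` and is within the factor of the running sup
  have hval_ge : ∀ k : ℕ, (1 - 1 / ((k : ℝ) + 2)) * sSup (V (tn k)) ≤ ‖u (tn k) (xn k)‖ := fun k => by
    have hmono : sSup (V (tn k)) ≤ sSup (V (s k)) :=
      csSup_le_csSup (hVbdd (s k) (hs k).2) (hVne (tn k) (htn k).1)
        (image_mono (prod_mono (Icc_subset_Icc_right (htn k).2) Subset.rfl))
    have hc : 0 ≤ 1 - 1 / ((k : ℝ) + 2) := by
      have : (1 : ℝ) / ((k : ℝ) + 2) ≤ 1 := by rw [div_le_one (by positivity)]; linarith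
      linarith
    exact (mul_le_mul_of_nonneg_left hmono hc).trans (hxn k).le
  have hval_le : ∀ k, ‖u (tn k) (xn k)‖ ≤ sSup (V (tn k)) := fun k =>
    hle (tn k) (htT k) (tn k) ⟨(htn k).1, le_rfl⟩ (xn k)
  have hval_big : ∀ k, R k / 2 < ‖u (tn k) (xn k)‖ := fun k => by
    have hhalf : (1 : ℝ) / 2 ≤ 1 - 1 / ((k : ℝ) + 2) := by
      have : (1 : ℝ) / ((k : ℝ) + 2) ≤ 1 / 2 := by
        rw [div_le_div_iff₀ (by positivity) (by positivity)]; linarith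
      linarith
    have h1 : R k / 2 < (1 - 1 / ((k : ℝ) + 2)) * sSup (V (s k)) := by
      have := hy k
      have h2 : ‖u (s k) (y k)‖ ≤ sSup (V (s k)) := hle (s k) (hs k).2 (s k) ⟨(hs k).1, le_rfl⟩ (y k)
      nlinarith [hM k]
    exact h1.trans (hxn k)
  refine ⟨tn, lamn, xn, fun k => ⟨?_, htT k⟩, fun k => inv_pos.2 (hM' k), ?_, fun k t ht x => ?_, ?_⟩
  · -- `tn k ≥ T/2`: otherwise `‖u (tn k) (xn k)‖ ≤ N₁ < R k / 2`
    by_contra hlt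
    push Not at hlt
    have h1 := hbN₁ (tn k) ⟨(htn k).1, hlt.le⟩ (xn k)
    have h2 : N₁ < R k / 2 := by
      have hk0 : (0 : ℝ) ≤ (k : ℝ) := Nat.cast_nonneg k
      show N₁ < ((k : ℝ) + 2) * (N₁ + 1) / 2
      nlinarith [hN₁, hk0]
    linarith [hval_big k]
  · -- `λ k → 0`: `λ k ≤ 1 / ‖u (tn k) (xn k)‖ < 2 / R k → 0`
    have hR_top : Tendsto R atTop atTop := by
      refine Filter.Tendsto.atTop_mul_const (by linarith) ?_
      exact tendsto_natCast_atTop_atTop.atTop_add tendsto_const_nhds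
    have h2R : Tendsto (fun k => 2 / R k) atTop (𝓝 0) := tendsto_const_nhds.div_atTop hR_top
    refine squeeze_zero (fun k => (inv_pos.2 (hM' k)).le) (fun k => ?_) h2R
    have hv : 0 < ‖u (tn k) (xn k)‖ := (half_pos (hRpos k)).trans (hval_big k)
    calc lamn k = (sSup (V (tn k)))⁻¹ := rfl
      _ ≤ (‖u (tn k) (xn k)‖)⁻¹ := inv_anti₀ hv (hval_le k)
      _ ≤ 2 / R k := by
          rw [inv_eq_one_div, div_le_div_iff₀ hv (hRpos k)]
          linarith [hval_big k]
  · -- the gauge bound on `[0, tn k]`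
    have h := hle (tn k) (htT k) t ht x
    calc lamn k * ‖u t x‖ ≤ lamn k * sSup (V (tn k)) :=
          mul_le_mul_of_nonneg_left h (inv_pos.2 (hM' k)).le
      _ = 1 := inv_mul_cancel₀ (hM' k).ne'
  · -- `λ k ‖u (tn k) (xn k)‖ → 1`: squeezed between `1 - 1/(k+2)` and `1`
    have hlow : ∀ k : ℕ, 1 - 1 / ((k : ℝ) + 2) ≤ lamn k * ‖u (tn k) (xn k)‖ := fun k => by
      have h := mul_le_mul_of_nonneg_left (hval_ge k) (inv_pos.2 (hM' k)).le
      calc 1 - 1 / ((k : ℝ) + 2) = (sSup (V (tn k)))⁻¹ * ((1 - 1 / ((k : ℝ) + 2)) * sSup (V (tn k))) := by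
            rw [mul_comm (1 - 1 / ((k : ℝ) + 2)) (sSup (V (tn k))), inv_mul_cancel_left₀ (hM' k).ne']
        _ ≤ lamn k * ‖u (tn k) (xn k)‖ := h
    have hup : ∀ k, lamn k * ‖u (tn k) (xn k)‖ ≤ 1 := fun k => by
      calc lamn k * ‖u (tn k) (xn k)‖ ≤ lamn k * sSup (V (tn k)) :=
            mul_le_mul_of_nonneg_left (hval_le k) (inv_pos.2 (hM' k)).le
        _ = 1 := inv_mul_cancel₀ (hM' k).ne'
    have hlim : Tendsto (fun k : ℕ => 1 - 1 / ((k : ℝ) + 2)) atTop (𝓝 1) := by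
      have h : Tendsto (fun k : ℕ => 1 / ((k : ℝ) + 2)) atTop (𝓝 0) :=
        tendsto_const_nhds.div_atTop (tendsto_natCast_atTop_atTop.atTop_add tendsto_const_nhds)
      simpa using (tendsto_const_nhds (x := (1 : ℝ))).sub h
    exact tendsto_of_tendsto_of_tendsto_of_le_of_le hlim tendsto_const_nhds hlow hup

/-- **TEMPLATE (I-2) FROM THE STANDING HYPOTHESES AND UNBOUNDEDNESS ALONE.** Let `u` be a classical solution
(`ν = 1`, unforced) on `[0, T⋆) × ℝ³`, `T⋆ > 0`, bounded and of bounded energy on every closed sub-slab, and UNBOUNDED on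
`[0, T⋆) × ℝ³` (a finite-time singularity at `T⋆` in the sense of KNSS Prop. 6.1). Then for some `tₖ, xₖ, λₖ` as in
`exists_zoom_data_of_unbounded`, a subsequence of the N-a zoom converges slice-wise locally uniformly at every `s < 0`
to a KNSS blow-up limit — the inner object of the template EXISTS, with its convergence, by decl. [new here — dictionary] -/
theorem innerLimit_exists_of_unbounded (hT : 0 < T) (hu : IsClassicalNSSolutionOn (Ico 0 T) 1 0 u p)
    (hE : ∀ S < T, ∃ C : ℝ≥0∞, C < ⊤ ∧ ∀ t ∈ Icc 0 S, ∫⁻ x, ‖u t x‖ₑ ^ 2 ≤ C)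
    (hbdd : ∀ S < T, ∃ N : ℝ, 0 < N ∧ ∀ t ∈ Icc 0 S, ∀ x, ‖u t x‖ ≤ N)
    (hunb : ∀ N : ℝ, ∃ t ∈ Ico 0 T, ∃ x : EuclideanSpace ℝ (Fin 3), N < ‖u t x‖) :
    ∃ (tn lamn : ℕ → ℝ) (xn : ℕ → EuclideanSpace ℝ (Fin 3)) (φ : ℕ → ℕ)
      (W : ℝ → EuclideanSpace ℝ (Fin 3) → EuclideanSpace ℝ (Fin 3)),
      (∀ k, T / 2 ≤ tn k ∧ tn k < T) ∧ (∀ k, 0 < lamn k) ∧ Tendsto lamn atTop (𝓝 0) ∧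
      (∀ k, ∀ t ∈ Icc 0 (tn k), ∀ x, lamn k * ‖u t x‖ ≤ 1) ∧ StrictMono φ ∧ IsKNSSBlowupLimit W ∧
      ∀ s < 0, TendstoLocallyUniformly
        (fun k => (lamn (φ k) • stPull (lamn (φ k) ^ 2) (lamn (φ k)) (tn (φ k)) (xn (φ k)) u) s) (W s) atTop := by
  obtain ⟨tn, lamn, xn, htn, hlam, hlam0, hgauge, hnear⟩ := exists_zoom_data_of_unbounded (u := u) hT hbdd hunb
  obtain ⟨φ, W, hφ, hW, hconv⟩ := innerLimit_exists_of_blowup_zoom hu hE hbdd (t₁ := T / 2) (half_pos hT) htn hlam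
    hlam0 hgauge hnear
  exact ⟨tn, lamn, xn, φ, W, htn, hlam, hlam0, hgauge, hφ, hW, hconv⟩

end ZoomOseen

end TypeIIModulationDictionary
end Summit.NavierStokesRegularity.OSWSelfSimilar
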